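import Literature.MathematicalPhysics.QuantumFieldTheory.Balaban1983to89.B8Prop7AdmittedFamily
import Literature.MathematicalPhysics.QuantumFieldTheory.Balaban1983to89.B8Prop7ClassAkLocal
import Literature.MathematicalPhysics.QuantumFieldTheory.Balaban1983to89.B8LeafModelZd3

/-!
# `Balaban1983to89.B8Prop7GlevZd3` — [Balaban1985RegularSpaces] **Proposition 7** (Sect. G, p. 100, (1.144)–(1.145)) READ AT NODE 00's
# gauge-fixing carrier of record `B8LeafModelZd3.zdGF3`: (K1) the typed leaf conjunct `B8SectGH.Prop7PrintedR fam toAxial` is satisfied by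
# the map «forget `U₁`» (a HAZARD certificate: the sentence does not bind `toAxial` to `U₁`); (K2) the `𝔄_k`-clause of (1.144) at the
# carrier for EVERY unitary gauge representative, and the `Ax_k`-clause for [3]'s gauge fixing `glev` at EVERY truncation; (K3) on the
# members with `Ω_j = ℤᵈ` for all `j` (print p. 77 «we admit Ω_j = T_η») the REPAIRED sentence `B8Ineq145.Prop7RepairedC (530·d)` HOLDS in
# `zdGF3`'s (1.66)₁ box form of (1.35), for the honest map `U₁ ↦ U₁^{glev}` — lit-balaban r05's admitted-family theorems BY NAME

statement-level skeleton of published theorems with citation tags; proofs where landed; nothing here is a claim about the Yang–Mills mass gap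

T. Bałaban, *Spaces of regular gauge field configurations on a lattice and gauge fixing conditions*, Commun. Math. Phys. **99** (1985) 75–102
`[Balaban1985RegularSpaces]` ("B8"; journal page = PDF page + 74; PDF held `paper:balaban1985-cmp99-regular-spaces-gauge-fixing`, p. 100
[PDF 26] quoted verbatim in `B8SectGH` and `B8Prop7AdmittedFamily`); [3] = T. Bałaban, *Averaging operations for lattice gauge theories*,
Commun. Math. Phys. **98** (1985) 17–51 `[Balaban1985Averaging]` ((55) p. 27, (67) p. 29, (76)–(77) pp. 29–30, (87) p. 31).

## THE PRINTED TEXT (p. 100 [PDF 26], verbatim)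

*"Let us take a gauge transformation u satisfying the conditions (1.29) and such that the configuration U′ = (U₁U₀)^u U₀⁻¹ satisfies
the axial gauge conditions (1.19). This gauge transformation is determined uniquely. The above bounds imply the following*
**Proposition 7.** *If the configurations U₀, A satisfy (1.139), (1.140), then for α₀, α₂ sufficiently small we have
U′U₀ = (U₁U₀)^u ∈ 𝔄_k({Ω_j}, α₀ + 3α₂) ∩ Ax_k(𝔅_k, U₀), (1.144)   |(U′U₀)‾^j − Ū₀^j| = |exp iQ_j(U₀, ηA) − 1| < 2α₂ on Ω^{(j)}_j. (1.145)"*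

## WHY THIS FILE (cell `pub-ymgap`, HUMAN RULING D-0062; R134 seat `pub-ymgap-dag-n05-c` g4, DAG node N05 = [B8]; count-neutral)

After seat n05-d g3's append (`Summits/…/BalabanUVNodesN05SubBKnitZdLan` v1.1, `exists_c₁_b8LeafRS_subB_cut_zdLan_of_knit_lettersRDUB`)
the N05 knit of record displays exactly TWO printed members of [Balaban1985RegularSpaces] as hypotheses: `p7 : B8SectGH.Prop7PrintedR
(famB8OfRecordSubB θ λ.β λ.len ·) (λ.toAxial ·.1)` and `t8 : B8Thm8Surviving.Thm8SurvivingAt 1 …`, both flagged «species word first» by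
the planner (FAN-OUT §N05).  NODE 00's family of record is `famB8OfRecord θ β len i := zdGF3 θ.𝔸 θ.L β len i.1` over `IdxB8 θ = {i : ZdIdx //
i.Ω 0 = univ}` (`Node00/CarriersB8`), and Proposition 7's axial map `toAxial` is FREE residual data there (`ResidB8.toAxial`).  This file
gives the chair ∕ carver three KERNEL FACTS to word `p7` with — it does not give the word and types no new leaf predicate:

* (K1) `prop7PrintedR_zdGF3_unitAxial(_comp)`: the typed conjunct abstracts print's «U′U₀ = (U₁U₀)^u» into a parameter `toAxial i U₀ U₁`
  and constrains only its OUTPUT; the map `toAxialUnit` («return the unperturbed pair `(U₀, 1)`») satisfies `Prop7PrintedR` at every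
  `zdGF3` member over every index map (hence verbatim at `famB8OfRecord`, `famB8OfRecordSub`, `famB8OfRecordSubB` by unfolding) — the
  (1.144)-clause of the unperturbed pair is the monotonicity of `𝔄_k` in its constant and `B8Eq119TwistedAxial.inAx_self`, the
  (1.145)-clause is `‖x − x‖ = 0`.  So `p7` as bound is DISCHARGEABLE BY JUNK at any named `λ` with `λ.toAxial := toAxialUnit`: the
  conjunct is content-free until `toAxial` is PINNED to print's map (the cell's junk-certificate question R433 ∕ ref-E (f3), here for
  `ResidB8.toAxial`).
* (K2) `inAk_gaugeAct_of_c140`: at a member with `Ω₀ = ℤᵈ`, the carrier's own (1.139)/(1.140) (`(zdGF3 …).InA α₀ U₀`, `(zdGF3 …).C140 α₂ U₀ P`,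
  the `mlogCfg` reading) and `α₀, α₂ ≤ 1/(80d)` give «(U₁U₀)^u ∈ 𝔄_k({Ω_j}, α₀ + 3α₂)» for EVERY `U(𝔸)`-valued `u` — p40 g5's
  `B8Prop7ClassAkLocal.inAk_mulCfg_gaugeAct_hermitian_loc` BY NAME behind the dictionary `c140_dictionary` (`A := mlogCfg`, the two
  exponent spellings `B8Prop3GaugeFixedKLevel.expCfg_iEta_eq_cfgExp`, `SideTouches ⊃ BondTouches` for `d ≥ 2`); `inAx_glev_le`: the
  `Ax_k`-clause for [3]'s global gauge fixing `B7Eq84Concrete.glev … k 0` at EVERY truncation `m ≤ k` and EVERY constraint family `Λ`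
  (pure algebra, `B7Eq84Concrete.axialGauge_glev` + `B8Eq131Derivation.ax119_iff_ax67`; `B8Prop7AdmittedFamily.inAx_glev` is the
  top-level family `LamTop`); `toAxialGlev` = lit-balaban r05 g7's `B8Prop7AdmittedFamily.toAxialGF` READ AT `zdGF3` (totalised by cases
  on the unitarity of `glev`, which holds in the small-field regime only), `inAAx_toAxialGlev` = the whole (1.144)-clause of the leaf's
  conclusion wherever `glev` is unitary-valued.
* (K3) `prop7_zdGF3_univ_explicit`, `prop7RepairedC_zdGF3_univ`: on the sub-family `{i : ZdIdx d L // ∀ j, i.Ω j = univ}` (print's admitted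
  «Ω_j = T_η» at EVERY level) r05 g7's `prop7_admitted_explicit` ∕ `ineq145_allLevels_admitted_explicit` BY NAME give: `glev` unitary,
  (1.144) both clauses at every truncation, and (1.145) in `zdGF3`'s (1.66)₁ BOX FORM of (1.35) (`avgClose`: every level-`j` bond whose box
  lies in `Ω_j`, here EVERY bond, EVERY `j ≤ k`) with constant `530d·α₂`; print's `2α₂` at the top level `j = k` (`prop7_admitted_explicit`
  (iv)).  Hence `B8Ineq145.Prop7RepairedC (530·d)` at the record's own carrier on that sub-family for `toAxialGlev`.

## LOCATED FOR THE SPECIES WORD (census; nothing below is typed here)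

(a) `p7` AS TYPED is junk-satisfiable (K1).  (b) The honest object at a GENERAL member of `IdxB8` (towers of several heights) is print's
(1.29)-restricted TOWER-WISE axial gauge — `u = glev` of depth `j` on each tower `Bʲ(y)`, `y ∈ Λ_j` (this is what (1.19) + (1.29) determine,
p. 100 «determined uniquely») — NOT the global `glev … k 0` of (K2)/(K3) (outside `Ω_k` the level-`k` block frames of a general member are
not small, so `glev … k 0` is not even unitary-valued there); its well-definedness wants the towers `Bʲ(y)`, `y ∈ Λ_j`, `j ≤ k`, pairwise
DISJOINT — print's (1.5) `Λ_j := Ω_j^{(j)} ∖ Ω_{j+1}^{(j)}` — a law the indices `ZdIdx` ∕ `IdxB8LawsB` do not carry (`hpart` is a cover,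
not a partition): typer ∕ pin item.  (c) The (1.145)-half in `zdGF3`'s BOX FORM with print's constant `2α₂` is certified NOWHERE below the
top level: for the admitted family r05 g7 certifies `530d·α₂` at the levels `j < k` (the EQUALITY in (1.145) fails there on the tree
bonds of the axial gauge, `B8Ineq145` (a)); for the half-space family with print's restricted `u` the constant `2α₂` is REFUTED
(`B8Prop7HalfSpace.not_prop7PrintedR_halfspace`, repaired `202dL`, G-B8-01).  R453 (B) chose the box form of `avgClose` because for
THEOREM 2 (1.35) is a HYPOTHESIS (stronger hypothesis, weaker theorem); for PROPOSITION 7 it is the CONCLUSION, where the box form is the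
STRONGER reading.  The consumer-safe bookable shape is `B8Ineq145.Prop7RepairedC C(d, L)` (`B8Ineq145.thm2_after_prop7RepairedC`: Theorem 2
is entered at `α₁ := C·α₂`, «sufficiently small» unchanged).

## HONEST SCOPE

Kernel bookkeeping and by-name instantiation of landed theorems (`B8Prop7AdmittedFamily`, `B8Prop7ClassAkLocal`, `B7Eq84Concrete`,
`B8Eq131Derivation`); NO estimate of [Balaban1985RegularSpaces] or [3] is proved anew or asserted; `toAxialGlev` off the small-field regime
is junk by construction (the `else` branch) and is NOT print's map at a general member ((b) above); nothing of Theorem 8 is touched.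
Count-neutral; N05 NOT discharged; `T_η ↦ ℤᵈ` carriers, `G = U(𝔸)`; one finite `T⁴` programme at fixed `ε`, Bałaban as printed — nothing
continuum ∕ ℝ⁴ ∕ OS ∕ mass-gap ∕ Clay.  No `sorry`, no `axiom`, no `instance`, no `notation`.  Unit `pub-ymgap-dag-n05-c` (g4), 2026-08-27.

[cite: Balaban1985RegularSpaces, Prop. 7 (1.144)–(1.145) p.100, (1.139)–(1.140) p.100, (1.19)–(1.20) p.79, (1.29) p.81, (1.35) p.82,
(1.66) p.88, (1.5) p.77, p.77 («we admit Ω_j = T_η»); Balaban1985Averaging, (55) p.27, (67) p.29, (76)–(77) pp.29–30, (87) p.31]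
-/

noncomputable section

open NormedSpace

namespace Literature.MathematicalPhysics.QuantumFieldTheory.Balaban1983to89.B8Prop7GlevZd3

open B7Prop1Explicit B7Prop2Explicit B7Eq92Concrete B7Eq84Concrete
open B7Prop8PrintedConstants (Rc_mem_unitaryUnits)
open B8Lemma1NonAbelian (mulCfg)
open B8Eq146AExpansion (iEta expCfg plaqCovDeriv)
open B8Eq143PlaqExpansion (pdiv)
open B8Ineq132 (InAk CondAt BondTouches covDerivFwd)
open B8Eq119TwistedAxial (InAx Restr129 inAx_self)
open B8Eq131Derivation (ax119_iff_ax67)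
open B8Eq140Level (SideTouches Cond140 sideTouches_of_bondTouches)
open B8Eq184Proof (cfgExp)
open B8Prop3GaugeFixedKLevel (expCfg_iEta_eq_cfgExp)
open B8Prop7ClassAkLocal (inAk_mulCfg_gaugeAct_hermitian_loc)
open B8Prop7AdmittedFamily (cst cst_pos prop7_admitted_explicit ineq145_allLevels_admitted_explicit mgauge_mul_eq_gaugeAct_mulCfg)
open B8Thm4Concrete (mulCfg_eq_mul)
open B8LeafModelZd (ZdIdx)
open B8LeafModelZd3 (zdGF3 mlogCfg)

-- `Site` alone could resolve to the torus sites of `Setup.lean`; re-export the `ℤ^d` sites of `B7Prop1Explicit`.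
export B7Prop1Explicit (Site)

variable {d : ℕ}

/-! ## §1 Bookkeeping: `(1·U₀) = U₀`, monotonicity of `𝔄_k` in its constant, unitarity of the moving-frame action, every bond touches `ℤᵈ` -/

section Bookkeeping

variable {𝔸 : Type*} [CStarAlgebra 𝔸]

/-- `U′U₀ = U₀` for the trivial perturbation `U′ = 1` (bookkeeping for the unperturbed pair). [cite: Balaban1985RegularSpaces, (1.16) p.78 (bookkeeping)] -/
theorem one_mulCfg (U₀ : Site d → Fin d → 𝔸ˣ) : mulCfg (1 : Site d → Fin d → 𝔸ˣ) U₀ = U₀ := by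
  rw [mulCfg_eq_mul, one_mul]

/-- **`𝔄_k({Ω_j}, α) ⊂ 𝔄_k({Ω_j}, α′)` for `α ≤ α′`** (p. 77, (1.7)–(1.8): both members of the class condition are strict upper bounds
proportional to the constant). [cite: Balaban1985RegularSpaces, (1.7)–(1.8) p.77] -/
theorem inAk_mono_alpha {L k : ℕ} {η α α' : ℝ} (hη : 0 < η) (hαα' : α ≤ α') {Ω : ℕ → Set (Site d)}
    {V : Site d → Fin d → 𝔸ˣ} (h : InAk L k η α Ω V) : InAk L k η α' Ω V := by
  intro j hj
  obtain ⟨h1, h2⟩ := h j hj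
  refine ⟨fun x μ ν hμν hp => lt_of_lt_of_le (h1 x μ ν hμν hp) (mul_le_mul_of_nonneg_right hαα' (by positivity)),
    fun x μ hb => lt_of_lt_of_le (h2 x μ hb) ?_⟩
  have h0 : (0 : ℝ) ≤ (((L : ℝ) ^ j)⁻¹) ^ 2 * ((L : ℝ) ^ j * η)⁻¹ := by positivity
  calc α * (((L : ℝ) ^ j)⁻¹) ^ 2 * ((L : ℝ) ^ j * η)⁻¹ = α * ((((L : ℝ) ^ j)⁻¹) ^ 2 * ((L : ℝ) ^ j * η)⁻¹) := by ring
    _ ≤ α' * ((((L : ℝ) ^ j)⁻¹) ^ 2 * ((L : ℝ) ^ j * η)⁻¹) := mul_le_mul_of_nonneg_right hαα' h0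
    _ = α' * (((L : ℝ) ^ j)⁻¹) ^ 2 * ((L : ℝ) ^ j * η)⁻¹ := by ring

/-- The moving-frame action (1.17) = [3] (55), `U₁ ↦ u(b₋)·U₁(b)·(R(U₀(b))u(b₊))⁻¹`, preserves `U(𝔸)`-valuedness for `U(𝔸)`-valued `u`,
`U₀`, `U₁`. [cite: Balaban1985RegularSpaces, (1.17) p.78; Balaban1985Averaging, (55) p.27] -/
theorem mgauge_mem_unitaryUnits {U₀ U₁ : Site d → Fin d → 𝔸ˣ} {u : Site d → 𝔸ˣ} (hU₀ : ∀ x κ, U₀ x κ ∈ unitaryUnits 𝔸)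
    (hU₁ : ∀ x κ, U₁ x κ ∈ unitaryUnits 𝔸) (hu : ∀ x, u x ∈ unitaryUnits 𝔸) (x : Site d) (κ : Fin d) :
    mgauge U₀ u U₁ x κ ∈ unitaryUnits 𝔸 := by
  rw [mgauge_apply]
  exact (unitaryUnits 𝔸).mul_mem ((unitaryUnits 𝔸).mul_mem (hu x) (hU₁ x κ))
    ((unitaryUnits 𝔸).inv_mem (Rc_mem_unitaryUnits (hU₀ x κ) (hu _)))

omit [CStarAlgebra 𝔸] in
/-- On `Ω₀ = ℤᵈ` every bond is a side of a plaquette touching `Ω₀` (`d ≥ 2`: a second lattice direction exists).  The same sentence is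
`Summit.QuantumFields.YangMills.BalabanUVNodes.N16.Thm4ZdOfLeaf.sideTouches_univ` (a Summits-side file a Literature module cannot import; restated,
three lines). [cite: Balaban1985RegularSpaces, p.77 (bond ∕ plaquette convention)] -/
theorem sideTouches_of_univ (hd2 : 2 ≤ d) (y : Site d) (τ : Fin d) : SideTouches (Set.univ : Set (Site d)) y τ := by
  haveI : Nontrivial (Fin d) := Fin.nontrivial_iff_two_le.mpr hd2
  obtain ⟨κ, hκ⟩ := exists_ne τ
  exact sideTouches_of_bondTouches hκ (Or.inl (Set.mem_univ y))

/-- **The `Ax_k`-clause of (1.144) for [3]'s gauge fixing, at EVERY truncation and EVERY constraint family**: for `u = glev … k 0` ((76)–(77),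
(87) of [3]) the field `U′U₀ = (U₁U₀)^u`, `U′ = U₁^{u}` in the moving frame (55), satisfies (1.19) `InAx L m Λ U₀ (U′U₀)` for every `m ≤ k` and
every `Λ` — (1.19) below a site of `Λ_j`, `j ≤ m`, asks the block axial gauge (67) at the levels `n < j ≤ m ≤ k`, which `glev` satisfies on
EVERY block of EVERY level `< k` (`B7Eq84Concrete.axialGauge_glev`; the two typings agree by `B8Eq131Derivation.ax119_iff_ax67`).  Pure
algebra: every `U₀`, `U₁`, no smallness (`B8Prop7AdmittedFamily.inAx_glev` is the case `m = k`, `Λ = LamTop k`).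
[cite: Balaban1985RegularSpaces, (1.19) p.79, (1.144) p.100; Balaban1985Averaging, (67) p.29, (76)–(77) pp.29–30, (87) p.31] -/
theorem inAx_glev_le (L : ℕ) (hL1 : 1 ≤ L) {k m : ℕ} (hm : m ≤ k) (Λ : ℕ → Set (Site d)) (U₀ U₁ : Site d → Fin d → 𝔸ˣ) :
    InAx L m Λ U₀ (mgauge U₀ (glev L hL1 U₀ U₁ k 0) U₁ * U₀) := by
  intro j _ hjm xj _ n hn z _ r
  rw [ax119_iff_ax67]
  exact axialGauge_glev L hL1 U₀ U₁ k n (by omega) z r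

end Bookkeeping

/-! ## §2 The two maps on the carrier of record: «forget `U₁`» and «`U₁ ↦ U₁^{glev}`» -/

section Maps

variable (𝔸 : Type) [CStarAlgebra 𝔸] [Nontrivial 𝔸] (L : ℕ) (β : ℝ) (len : Site d → ℝ)

/-- The unperturbed pair `(U₀, 1)` as a point of the perturbation carrier of `zdGF3` (background `U₀`, `U′ := 1`, so `U′U₀ = U₀`).
[cite: Balaban1985RegularSpaces, (1.16)–(1.17) p.78 (bookkeeping)] -/
def unitPert (i : ZdIdx d L) (U₀ : (zdGF3 𝔸 L β len i).Cfg) : (zdGF3 𝔸 L β len i).Pert :=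
  (U₀, ⟨1, fun _ _ => (unitaryUnits 𝔸).one_mem⟩)

/-- **«Forget `U₁`»**: the map `(U₀, U₁) ↦ (U₀, 1)` in the slot of Proposition 7's axial map — NOT print's map; the JUNK witness of (K1).
[cite: Balaban1985RegularSpaces, Prop. 7 p.100 (bookkeeping: a non-printed map in the typed slot)] -/
def toAxialUnit : ∀ i : ZdIdx d L, (zdGF3 𝔸 L β len i).Cfg → (zdGF3 𝔸 L β len i).Pert → (zdGF3 𝔸 L β len i).Pert :=
  fun i U₀ _ => unitPert 𝔸 L β len i U₀

open Classical in
/-- **`U₁ ↦ U′ = U₁^{u}`, `u = glev … k 0`** — lit-balaban r05 g7's `B8Prop7AdmittedFamily.toAxialGF` ([3]'s gauge fixing (76)–(77) + (87)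
acting in the moving frame (55) = (1.17), so that `U′U₀ = (U₁U₀)^u`) READ AT THE CARRIER `zdGF3`, whose perturbations are `U(𝔸)`-valued:
the map is `(U₀, U₁^{glev})` when `glev` is `U(𝔸)`-valued (the small-field regime, `B8Prop7AdmittedFamily.glev_mem_unitaryUnits`) and the
unperturbed pair otherwise (totalisation; junk off the regime).  On a member with towers of several heights this is NOT print's
(1.29)-restricted tower-wise map (module docstring, LOCATED (b)). [cite: Balaban1985RegularSpaces, (1.144) p.100, (1.17) p.78, (1.19) p.79; Balaban1985Averaging, (55) p.27, (76)–(77) pp.29–30, (87) p.31] -/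
def toAxialGlev (hL1 : 1 ≤ L) :
    ∀ i : ZdIdx d L, (zdGF3 𝔸 L β len i).Cfg → (zdGF3 𝔸 L β len i).Pert → (zdGF3 𝔸 L β len i).Pert :=
  fun i U₀ P =>
    if h : ∀ x, glev L hL1 U₀.1 P.2.1 i.k 0 x ∈ unitaryUnits 𝔸 then
      (U₀, ⟨mgauge U₀.1 (glev L hL1 U₀.1 P.2.1 i.k 0) P.2.1, mgauge_mem_unitaryUnits U₀.2 P.2.2 h⟩)
    else unitPert 𝔸 L β len i U₀

variable {𝔸 L β len}

omit [Nontrivial 𝔸] in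
/-- `toAxialGlev` in the regime where `glev` is `U(𝔸)`-valued: the pair `(U₀, U₁^{glev})`. [cite: Balaban1985RegularSpaces, (1.144) p.100 (bookkeeping)] -/
theorem toAxialGlev_of_unitary (hL1 : 1 ≤ L) (i : ZdIdx d L) (U₀ : (zdGF3 𝔸 L β len i).Cfg) (P : (zdGF3 𝔸 L β len i).Pert)
    (h : ∀ x, glev L hL1 U₀.1 P.2.1 i.k 0 x ∈ unitaryUnits 𝔸) :
    toAxialGlev 𝔸 L β len hL1 i U₀ P =
      (U₀, ⟨mgauge U₀.1 (glev L hL1 U₀.1 P.2.1 i.k 0) P.2.1, mgauge_mem_unitaryUnits U₀.2 P.2.2 h⟩) :=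
  dif_pos h

end Maps

/-! ## §3 (K1) The typed conjunct `Prop7PrintedR` is satisfied by «forget `U₁`» — a HAZARD certificate -/

section Junk

variable {𝔸 : Type} [CStarAlgebra 𝔸] [Nontrivial 𝔸] {L : ℕ} {β : ℝ} {len : Site d → ℝ}

omit [Nontrivial 𝔸] in
variable (𝔸 L β len) in
/-- **(K1) HAZARD CERTIFICATE — the typed Proposition 7 does not bind its axial map to `U₁`.**  `B8SectGH.Prop7PrintedR fam toAxial` reads
«∃ c > 0, ∀ i, ∀ α₀, α₂ ∈ (0, c], ∀ U₀ U₁, (1.139) → (1.140) → `InAAx (α₀ + 3α₂) U₀ (toAxial i U₀ U₁) ∧ avgClose (2α₂) U₀ (toAxial i U₀ U₁)`»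
and constrains only the OUTPUT of `toAxial`; print's «U′U₀ = (U₁U₀)^u» lives in the intended reading of the slot, not in the sentence.  For
the map `toAxialUnit` («return `(U₀, 1)`») over ANY index map `e : J → ZdIdx d L` into the carrier of record: the (1.144)-clause of the
unperturbed pair is `U₀ ∈ 𝔄_k(α₀) ⊂ 𝔄_k(α₀ + 3α₂)` (`inAk_mono_alpha`) and `U₀ ∈ Ax_k(ℭ, U₀)` at every truncation
(`B8Eq119TwistedAxial.inAx_self`), the (1.145)-clause is `‖(Ū₀ʲ)_b − (Ū₀ʲ)_b‖ = 0 ≤ 2α₂`.  CONSEQUENCE (census, not a claim about print):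
at any NAMED residual layer `λ` with `λ.toAxial := toAxialUnit ∘ …` the N05 knit's hypothesis `p7` holds by this theorem — `p7` carries
content only once `toAxial` is pinned to print's map. [cite: Balaban1985RegularSpaces, Prop. 7 (1.144)–(1.145) p.100 (typed sentence, junk witness)] -/
theorem prop7PrintedR_zdGF3_unitAxial_comp {J : Type} (e : J → ZdIdx d L) :
    B8SectGH.Prop7PrintedR (fun j => zdGF3 𝔸 L β len (e j)) (fun j => toAxialUnit 𝔸 L β len (e j)) := by
  refine ⟨1, one_pos, ?_⟩
  intro j α₀ α₂ _ _ hα₂ _ U₀ P hInA _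
  refine ⟨⟨rfl, ?_, fun m _ => ?_⟩, fun l _ z μ _ => ?_⟩
  · show InAk L (e j).k (e j).η (α₀ + 3 * α₂) (e j).Ω (mulCfg 1 U₀.1)
    rw [one_mulCfg]
    exact inAk_mono_alpha (e j).hη (by linarith) hInA
  · show InAx L m ((e j).Λs m) U₀.1 (mulCfg 1 U₀.1)
    rw [one_mulCfg]
    exact inAx_self L m _ U₀.1
  · show ‖((avgIter L (mulCfg 1 U₀.1) l z μ : 𝔸ˣ) : 𝔸) - ((avgIter L U₀.1 l z μ : 𝔸ˣ) : 𝔸)‖ ≤ 2 * α₂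
    rw [one_mulCfg, sub_self, norm_zero]
    positivity

omit [Nontrivial 𝔸] in
variable (𝔸 L β len) in
/-- (K1) on the full carrier index `ZdIdx d L` (`e := id`); the faces at NODE 00's `famB8OfRecord θ β len = zdGF3 θ.𝔸 θ.L β len ∘ Subtype.val`
and its sub-family variants are the instances `e := Subtype.val`, `e := (·.1)`, `e := (·.1.1)` of `prop7PrintedR_zdGF3_unitAxial_comp`.
[cite: Balaban1985RegularSpaces, Prop. 7 (1.144)–(1.145) p.100 (typed sentence, junk witness)] -/
theorem prop7PrintedR_zdGF3_unitAxial :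
    B8SectGH.Prop7PrintedR (fun i : ZdIdx d L => zdGF3 𝔸 L β len i) (toAxialUnit 𝔸 L β len) :=
  prop7PrintedR_zdGF3_unitAxial_comp 𝔸 L β len id

end Junk

/-! ## §4 (K2) The dictionary from the carrier's (1.140) and the `𝔄_k`-clause of (1.144) for EVERY unitary gauge representative -/

section Dictionary

variable {𝔸 : Type} [CStarAlgebra 𝔸] [Nontrivial 𝔸] {L : ℕ} {β : ℝ} {len : Site d → ℝ}

omit [Nontrivial 𝔸] in
/-- **The carrier's (1.140) read as p40's `Cond140` for the canonical exponent.**  At a member with `Ω₀ = ℤᵈ` (`d ≥ 2`, `L ≥ 1`),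
`(zdGF3 …).C140 α₂ U₀ P` — «`U₁ = exp iηA`, `A` self-adjoint, `Lʲη|A|, (Lʲη)²|∇^η_{U₀}A|, (Lʲη)³|D^{η*}_{U₀}D^η_{U₀}A| < α₂` on the sides of the
plaquettes touching `Ω_j`, `j ≤ k`» for `A := mlogCfg k η Ω U₁` — gives: `A` self-adjoint EVERYWHERE and `U₁ = e^{iηA}` as configurations
(every bond is a side touching `Ω₀ = ℤᵈ`), and `B8Eq140Level.Cond140 L η α₂ j (Ω j) U₀ A` at every `j ≤ k` (the third member on the bonds
touching `Ω_j` ⊂ the sides touching `Ω_j`). [cite: Balaban1985RegularSpaces, (1.140) p.100, (1.41) p.83, p.77 (bond convention)] -/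
theorem c140_dictionary (hd2 : 2 ≤ d) (hL : 1 ≤ L) (i : ZdIdx d L) (hΩ0 : i.Ω 0 = Set.univ) {α₂ : ℝ}
    (U₀ : (zdGF3 𝔸 L β len i).Cfg) (P : (zdGF3 𝔸 L β len i).Pert) (h140 : (zdGF3 𝔸 L β len i).C140 α₂ U₀ P) :
    (∀ y τ, IsSelfAdjoint (mlogCfg i.k i.η i.Ω P.2.1 y τ)) ∧
      P.2.1 = expCfg (iEta i.η (mlogCfg i.k i.η i.Ω P.2.1)) ∧
      ∀ j, j ≤ i.k → Cond140 L i.η α₂ j (i.Ω j) U₀.1 (mlogCfg i.k i.η i.Ω P.2.1) := by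
  haveI : Nontrivial (Fin d) := Fin.nontrivial_iff_two_le.mpr hd2
  have hst0 : ∀ (y : Site d) (τ : Fin d), SideTouches (i.Ω 0) y τ := fun y τ => by
    rw [hΩ0]
    exact sideTouches_of_univ hd2 y τ
  have hLη : ∀ j : ℕ, (0 : ℝ) < (L : ℝ) ^ j * i.η := fun j => by
    have hL0 : (0 : ℝ) < L := by exact_mod_cast lt_of_lt_of_le Nat.zero_lt_one hL
    exact mul_pos (pow_pos hL0 _) i.hη
  refine ⟨fun y τ => (h140 0 (Nat.zero_le _) y τ (hst0 y τ)).2.1, ?_, fun j hj => ⟨fun y τ hs => ?_, fun y κ τ hs => ?_, fun y μ hb => ?_⟩⟩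
  · funext y τ
    rw [expCfg_iEta_eq_cfgExp]
    exact (h140 0 (Nat.zero_le _) y τ (hst0 y τ)).1
  · have h := (h140 j hj y τ hs).2.2.1
    rw [← div_eq_mul_inv, lt_div_iff₀ (hLη j), mul_comm]
    exact h
  · have h := (h140 j hj y τ hs).2.2.2.1 κ
    rw [inv_pow, ← div_eq_mul_inv, lt_div_iff₀ (pow_pos (hLη j) 2), mul_comm]
    exact h
  · obtain ⟨κ, hκ⟩ := exists_ne μ
    have h := (h140 j hj y μ (sideTouches_of_bondTouches hκ hb)).2.2.2.2
    rw [inv_pow, ← div_eq_mul_inv, lt_div_iff₀ (pow_pos (hLη j) 3), mul_comm]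
    exact h

/-- **(K2) THE `𝔄_k`-CLAUSE OF (1.144) AT THE CARRIER OF RECORD, FOR EVERY UNITARY GAUGE REPRESENTATIVE** «U′U₀ = (U₁U₀)^u ∈
𝔄_k({Ω_j}, α₀ + 3α₂)»: at a member with `Ω₀ = ℤᵈ` (`d ≥ 2`, `L ≥ 1`), from the carrier's (1.139) `InA α₀ U₀` and (1.140) `C140 α₂ U₀ P` and
`α₀, α₂ ≤ 1/(80d)`, for EVERY `U(𝔸)`-valued `u` — p40 g5's `B8Prop7ClassAkLocal.inAk_mulCfg_gaugeAct_hermitian_loc` BY NAME (the class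
`𝔄_k` is gauge invariant, (1.141)).  Whichever honest `u` is pinned for Proposition 7 (print's (1.29)-restricted tower-wise axial gauge),
this clause of the conclusion is served. [cite: Balaban1985RegularSpaces, Prop. 7 (1.144) p.100, (1.141) p.100, (1.7) p.77] -/
theorem inAk_gaugeAct_of_c140 (hd2 : 2 ≤ d) (hL : 1 ≤ L) (i : ZdIdx d L) (hΩ0 : i.Ω 0 = Set.univ) {α₀ α₂ : ℝ}
    (hα₀ : 0 < α₀) (hα₀c : α₀ ≤ 1 / (80 * d)) (hα₂ : 0 < α₂) (hα₂c : α₂ ≤ 1 / (80 * d))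
    (U₀ : (zdGF3 𝔸 L β len i).Cfg) (P : (zdGF3 𝔸 L β len i).Pert)
    (hInA : (zdGF3 𝔸 L β len i).InA α₀ U₀) (h140 : (zdGF3 𝔸 L β len i).C140 α₂ U₀ P)
    {u : Site d → 𝔸ˣ} (hu : ∀ x, u x ∈ unitaryUnits 𝔸) :
    InAk L i.k i.η (α₀ + 3 * α₂) i.Ω (gaugeAct u (mulCfg P.2.1 U₀.1)) := by
  obtain ⟨hAh, hU₁, hC⟩ := c140_dictionary hd2 hL i hΩ0 U₀ P h140
  have h := inAk_mulCfg_gaugeAct_hermitian_loc i.hη hL (fun y κ => unitaryUnits_le_U1 (U₀.2 y κ)) hAh hα₀.le hα₀c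
    hα₂.le hα₂c hInA hC (fun x => unitaryUnits_le_U1 (hu x))
  rwa [← hU₁] at h

/-- **(K2) THE WHOLE (1.144)-CLAUSE OF THE LEAF'S CONCLUSION FOR `toAxialGlev`, WHERE `glev` IS UNITARY-VALUED**: `(zdGF3 …).InAAx (α₀ + 3α₂)
U₀ (toAxialGlev … U₀ P)` = «background unchanged» ∧ «(U₁U₀)^{glev} ∈ 𝔄_k({Ω_j}, α₀ + 3α₂)» (`inAk_gaugeAct_of_c140` at `u := glev`, via
(1.17) `B8Prop7AdmittedFamily.mgauge_mul_eq_gaugeAct_mulCfg`) ∧ «(U₁U₀)^{glev} ∈ Ax_m(Λs m, U₀)` for every truncation `m ≤ k`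
(`inAx_glev_le`). [cite: Balaban1985RegularSpaces, Prop. 7 (1.144) p.100, (1.34) p.82, (1.19) p.79] -/
theorem inAAx_toAxialGlev (hd2 : 2 ≤ d) (hL : 1 ≤ L) (i : ZdIdx d L) (hΩ0 : i.Ω 0 = Set.univ) {α₀ α₂ : ℝ}
    (hα₀ : 0 < α₀) (hα₀c : α₀ ≤ 1 / (80 * d)) (hα₂ : 0 < α₂) (hα₂c : α₂ ≤ 1 / (80 * d))
    (U₀ : (zdGF3 𝔸 L β len i).Cfg) (P : (zdGF3 𝔸 L β len i).Pert)
    (hInA : (zdGF3 𝔸 L β len i).InA α₀ U₀) (h140 : (zdGF3 𝔸 L β len i).C140 α₂ U₀ P)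
    (h : ∀ x, glev L hL U₀.1 P.2.1 i.k 0 x ∈ unitaryUnits 𝔸) :
    (zdGF3 𝔸 L β len i).InAAx (α₀ + 3 * α₂) U₀ (toAxialGlev 𝔸 L β len hL i U₀ P) := by
  rw [toAxialGlev_of_unitary hL i U₀ P h]
  refine ⟨rfl, ?_, fun m hm => ?_⟩
  · show InAk L i.k i.η (α₀ + 3 * α₂) i.Ω (mulCfg (mgauge U₀.1 (glev L hL U₀.1 P.2.1 i.k 0) P.2.1) U₀.1)
    rw [mulCfg_eq_mul, mgauge_mul_eq_gaugeAct_mulCfg]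
    exact inAk_gaugeAct_of_c140 hd2 hL i hΩ0 hα₀ hα₀c hα₂ hα₂c U₀ P hInA h140 h
  · show InAx L m (i.Λs m) U₀.1 (mulCfg (mgauge U₀.1 (glev L hL U₀.1 P.2.1 i.k 0) P.2.1) U₀.1)
    rw [mulCfg_eq_mul]
    exact inAx_glev_le L hL hm (i.Λs m) U₀.1 P.2.1

end Dictionary

/-! ## §5 (K3) The members with `Ω_j = ℤᵈ` at every level: the REPAIRED Proposition 7 holds in the box form, by r05 g7's theorems -/

section Univ

variable {𝔸 : Type} [CStarAlgebra 𝔸] [Nontrivial 𝔸] {L : ℕ} {β : ℝ} {len : Site d → ℝ}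

/-- **(K3) PROPOSITION 7 AT A MEMBER OF THE CARRIER OF RECORD WITH `Ω_j = ℤᵈ` FOR ALL `j`, all inputs explicit** (print p. 77 «we admit
Ω_j = T_η»; `d ≥ 2`, `L ≥ 2`, `0 < α₀, α₂ ≤ c(d, L) = B8Prop7AdmittedFamily.cst d L`): from the carrier's (1.139) `InA α₀ U₀` and (1.140)
`C140 α₂ U₀ P` — (i) [3]'s gauge fixing `glev … k 0` of `U₁ = P.2` relative to `U₀` is `U(𝔸)`-valued (so `toAxialGlev` IS `(U₀, U₁^{glev})`);
(ii) (1.144), both clauses, in the carrier's `InAAx` at `α₀ + 3α₂` (every truncation); (iii) (1.145) IN THE CARRIER'S (1.66)₁ BOX FORM at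
EVERY level `j ≤ k` and EVERY bond: `|((U₁U₀)^{glev})‾ʲ_b − (Ū₀ʲ)_b| ≤ 530d·α₂` — r05 g7's `ineq145_allLevels_admitted_explicit`; (iv) at the
top level `j = k` print's constant: `≤ 2α₂` — `prop7_admitted_explicit` (iv).  BY NAME behind `c140_dictionary`; nothing re-proved.
[cite: Balaban1985RegularSpaces, Prop. 7 (1.144)–(1.145) p.100, (1.35) p.82, (1.66) p.88, p.77 («Ω_j = T_η»)] -/
theorem prop7_zdGF3_univ_explicit (hd2 : 2 ≤ d) (hL : 2 ≤ L) (i : ZdIdx d L) (hΩ : ∀ j, i.Ω j = Set.univ)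
    {α₀ α₂ : ℝ} (hα₀ : 0 < α₀) (hα₀c : α₀ ≤ cst d L) (hα₂ : 0 < α₂) (hα₂c : α₂ ≤ cst d L)
    (U₀ : (zdGF3 𝔸 L β len i).Cfg) (P : (zdGF3 𝔸 L β len i).Pert)
    (hInA : (zdGF3 𝔸 L β len i).InA α₀ U₀) (h140 : (zdGF3 𝔸 L β len i).C140 α₂ U₀ P) :
    (∀ x, glev L (le_trans one_le_two hL) U₀.1 P.2.1 i.k 0 x ∈ unitaryUnits 𝔸) ∧
      (zdGF3 𝔸 L β len i).InAAx (α₀ + 3 * α₂) U₀ (toAxialGlev 𝔸 L β len (le_trans one_le_two hL) i U₀ P) ∧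
      (∀ j, j ≤ i.k → ∀ (z : Site d) (κ : Fin d),
        ‖((avgIter L (mgauge U₀.1 (glev L (le_trans one_le_two hL) U₀.1 P.2.1 i.k 0) P.2.1 * U₀.1) j z κ : 𝔸ˣ) : 𝔸)
            - ((avgIter L U₀.1 j z κ : 𝔸ˣ) : 𝔸)‖ ≤ 530 * (d : ℝ) * α₂) ∧
      ∀ (z : Site d) (κ : Fin d),
        ‖((avgIter L (mgauge U₀.1 (glev L (le_trans one_le_two hL) U₀.1 P.2.1 i.k 0) P.2.1 * U₀.1) i.k z κ : 𝔸ˣ) : 𝔸)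
            - ((avgIter L U₀.1 i.k z κ : 𝔸ˣ) : 𝔸)‖ ≤ 2 * α₂ := by
  have hd : 1 ≤ d := le_trans one_le_two hd2
  have hL1 : 1 ≤ L := le_trans one_le_two hL
  -- the dictionary: `A := mlogCfg`, Hermitian, `U₁ = e^{iηA}`, (1.140) at every level
  obtain ⟨hAh, hU₁, hC⟩ := c140_dictionary hd2 hL1 i (hΩ 0) U₀ P h140
  set A := mlogCfg i.k i.η i.Ω P.2.1 with hAdef
  -- (1.139) on `Ω_j = ℤᵈ`
  have h139 : InAk L i.k i.η α₀ (fun _ => Set.univ) U₀.1 := fun j hj => by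
    show CondAt L i.η α₀ j Set.univ U₀.1
    rw [← hΩ j]
    exact hInA j hj
  -- (1.140) at the top level on ALL bonds (non-strict)
  have hsk : ∀ (y : Site d) (τ : Fin d), SideTouches (i.Ω i.k) y τ := fun y τ => by
    rw [hΩ i.k]
    exact sideTouches_of_univ hd2 y τ
  have hbk : ∀ (y : Site d) (μ : Fin d), BondTouches (i.Ω i.k) y μ := fun y μ => by
    rw [hΩ i.k]
    exact Or.inl (Set.mem_univ y)
  obtain ⟨hC1, hC2, hC3⟩ := hC i.k le_rfl
  have hA : ∀ y κ, ‖A y κ‖ ≤ α₂ * ((L : ℝ) ^ i.k * i.η)⁻¹ := fun y κ => (hC1 y κ (hsk y κ)).le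
  have hG : ∀ (y : Site d) (κ τ : Fin d), ‖covDerivFwd i.η U₀.1 κ (fun z => A z τ) y‖ ≤ α₂ * (((L : ℝ) ^ i.k * i.η)⁻¹) ^ 2 :=
    fun y κ τ => (hC2 y κ τ (hsk y τ)).le
  have hDDA : ∀ (y : Site d) (κ : Fin d), ‖pdiv i.η U₀.1 (plaqCovDeriv i.η U₀.1 A) κ y‖ ≤ α₂ * (((L : ℝ) ^ i.k * i.η)⁻¹) ^ 3 :=
    fun y κ => (hC3 y κ (hbk y κ)).le
  -- r05 g7's admitted-family theorems BY NAME, at `A`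
  obtain ⟨hu1, hAk, -, -, htop⟩ :=
    prop7_admitted_explicit hd hL hL1 i.k i.hη hα₀ hα₀c hα₂ hα₂c U₀.2 h139 hAh hA hG hDDA
  have hall := fun (j : ℕ) (hj : j ≤ i.k) (z : Site d) (κ : Fin d) =>
    ineq145_allLevels_admitted_explicit hd hL hL1 i.k i.hη hα₀ hα₀c hα₂ hα₂c U₀.2 h139 hAh hA hG hj z κ
  -- the two tree spellings of `e^{B}` agree by `rfl`
  have hU₁' : P.2.1 = B7Prop3Flat.expCfg (iEta i.η A) := hU₁
  rw [← hU₁'] at hu1 hAk htop hall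
  refine ⟨hu1, ?_, hall, htop⟩
  -- (1.144) in the carrier's `InAAx`
  rw [toAxialGlev_of_unitary hL1 i U₀ P hu1]
  refine ⟨rfl, ?_, fun m hm => ?_⟩
  · show InAk L i.k i.η (α₀ + 3 * α₂) i.Ω (mulCfg (mgauge U₀.1 (glev L hL1 U₀.1 P.2.1 i.k 0) P.2.1) U₀.1)
    rw [mulCfg_eq_mul]
    exact hAk i.Ω
  · show InAx L m (i.Λs m) U₀.1 (mulCfg (mgauge U₀.1 (glev L hL1 U₀.1 P.2.1 i.k 0) P.2.1) U₀.1)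
    rw [mulCfg_eq_mul]
    exact inAx_glev_le L hL1 hm (i.Λs m) U₀.1 P.2.1

variable (𝔸 β len) in
/-- **(K3) THE REPAIRED PROPOSITION 7 HOLDS AT THE CARRIER OF RECORD ON THE MEMBERS WITH `Ω_j = ℤᵈ` FOR ALL `j`**, for the honest map
`toAxialGlev`, in `zdGF3`'s (1.66)₁ BOX FORM of (1.35), with constant `530·d`: `B8Ineq145.Prop7RepairedC (530·d) (zdGF3 … ∘ Subtype.val)
(toAxialGlev …)` over `{i : ZdIdx d L // ∀ j, i.Ω j = univ}` (threshold `c(d, L) = B8Prop7AdmittedFamily.cst d L`; `d ≥ 2`, `L ≥ 2`, every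
C⋆-algebra `𝔸`).  A POSITIVE kernel instance of a repaired `p7` at NODE 00's own carrier (print's admitted «Ω_j = T_η»; these members lie
in `IdxB8`); print's `2α₂` in the box form below the top level is NOT claimed (LOCATED (c)). [cite: Balaban1985RegularSpaces, Prop. 7 (1.144)–(1.145) p.100, (1.66) p.88, p.77 («we admit Ω_j = T_η»)] -/
theorem prop7RepairedC_zdGF3_univ (hd2 : 2 ≤ d) {L : ℕ} (hL : 2 ≤ L) :
    B8Ineq145.Prop7RepairedC (530 * (d : ℝ))
      (fun i : {i : ZdIdx d L // ∀ j, i.Ω j = Set.univ} => zdGF3 𝔸 L β len i.1)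
      (fun i => toAxialGlev 𝔸 L β len (le_trans one_le_two hL) i.1) := by
  have hd : 1 ≤ d := le_trans one_le_two hd2
  have hL1 : 1 ≤ L := le_trans one_le_two hL
  refine ⟨cst d L, cst_pos hd L hL1, ?_⟩
  intro i α₀ α₂ hα₀ hα₀c hα₂ hα₂c U₀ P hInA h140
  obtain ⟨hu1, hAAx, hall, -⟩ := prop7_zdGF3_univ_explicit hd2 hL i.1 i.2 hα₀ hα₀c hα₂ hα₂c U₀ P hInA h140
  refine ⟨hAAx, ?_⟩
  show (zdGF3 𝔸 L β len i.1).avgClose (530 * (d : ℝ) * α₂) U₀ (toAxialGlev 𝔸 L β len hL1 i.1 U₀ P)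
  rw [toAxialGlev_of_unitary hL1 i.1 U₀ P hu1]
  intro j hj z μ _
  exact hall j hj z μ

end Univ

#print axioms prop7PrintedR_zdGF3_unitAxial
#print axioms inAk_gaugeAct_of_c140
#print axioms inAAx_toAxialGlev
#print axioms prop7_zdGF3_univ_explicit
#print axioms prop7RepairedC_zdGF3_univ

end Literature.MathematicalPhysics.QuantumFieldTheory.Balaban1983to89.B8Prop7GlevZd3

end
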